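import Summits.QuantumFields.YangMills.Theorems.BalabanUVNodesN11OmegaTopLocalResidual
import Summits.QuantumFields.YangMills.Theorems.BalabanUVNodesN11TopPairAtNewFieldShape

/-!
# DAG node N11 — THE Ω-TOP FAMILY READ THROUGH THE DOOR: at every parameter whose step-`n` residual factor of generation `k` has the NEW-FIELD SHAPE `ζ_k(Y)(ω) = g(Y)(V_{k+1})`
# ([III] (3.2): a function of the NEW gauge field `V_{k+1} = (ω (k+1)).1`), the new side of EVERY child with `Ω_{k+1}(s′) = 𝕋` is `g(∅)(V′)` TIMES 11a's fluctuation integral —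
# the profile read AT `V′`, not a constant — so at the first step g19's Ω-top test reads «𝐓-slot ≡ 0 OR `g(∅)(V′)·I(s′)(V′) = 0` a.e. on the rough support», met IDENTICALLY by a
# (3.2) CUT-OFF profile, and the (O3′) clause of every pair `(𝕋, Λ₁)` REDUCES EXACTLY to the (3.2)-small coarse fields (count-neutral, LOCATED; no pin of record is touched)

HEADER — WORK-UNIT METADATA.  Cell `pub-ymgap`, YM-PLAN Track A (HUMAN RULING D-0062), seat `pub-ymgap-dag-n11-d` (g33; N11 [B14], s2), route `BalabanUVNodes`, item K1⁹ =
stmt-QuantumFields-27364 (helper lane, `--kind proof --supports 27364 --as helper`, count-neutral).  [III] = [Balaban1988Convergent], [B7] = [Balaban1985Averaging], [I] =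
[Balaban1987RG1].  Over this seat's `…N11OmegaTopLocalResidual` (C; g19∕W2: under the displayed ONE-SCALE law `hzh` the new side of an Ω-top child is `c_k(s′) · I_k(s′)(V′)` with a
`V′`-independent constant; ★★ `slotsT_one_ae_zero_on_rough_of_Omega_univ` — the OLD side of every pair `(𝕋, Λ₁)` vanishes for a.e. rough `V′`, every `θ`), `…N11OmegaTopTStep.sect2Slot_eq_of_Omega_univ`
(g18 D2's closed form), `…N11TopPairAtNewFieldShape` (g33: the top pair through the door; `smallFieldIndicator_cut`, `not_oneScale_of_indicator`), g18 `…N11TopPairRoughSet` ∕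
`…RoughWitness` (`exists_cubeRoughStrict_of_lt_dist1`, `not_plaqSmall_of_cubeRough`, `nonempty_Iχ`), dag-n07-e's `su2_dist1_surj`, node00-def-T's RECORD 13 v1.7 `H` (`Stage13HParams.Zh`, `WtOfRecord₁₃H`,
`TLaw₁₃CoPH`, `tLaw₁₃CoPH_iff`).

WHY THIS FILE.  This seat's companion `…N11TopPairAtNewFieldShape` (g33) settles the top pair `(𝕋, 𝕋)` at a parameter whose step-1 residual factor has the new-field shape: non-degenerate, the (O3′) clause is its
restriction to the small fields.  g18∕g19's Ω-top family (every child with `Ω_{k+1}(s′) = 𝕋`, any `Λ_{k+1}`) carries the SAME residual factor `ζ_k(∅)` in front of 11a's fluctuation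
integral `I_k(s′)(V′) = Σ_Y aOp_k[w_k(Λ,Λᶜ,Y)·Π_{j<k}(ζ_j w_j)·exp A_{k+1}(s′; t, (S_Y, A), E′)](base_{k+1}V′)` (C §1), so the same substitution applies: under the DISPLAYED shape hypothesis
`hζ : ∀ Y ω, (θ.Zh p (k+1) s′.Ω s′.Λ).ζ0 k Y ω = g Y (ω (k+1)).1` the factor read at `base_{k+1}(V′)` is `g ∅ V′` (§1), the new side is `g ∅ V′ · I_k(s′)(V′)` (§1) and vanishes at every
`V′` the profile cuts off; at the first step (O3′) at a pair `(𝕋, Λ₁)` ⇒ «`slotT_1(s′) ≡ 0` OR `g ∅ V′ · I_0(s′)(V′) = 0` for a.e. rough `V′` of the support» (§2 — C §3 had the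
`V′`-independent «`c_0(s′) = 0` or `I_0(s′) = 0` a.e. there»), which a CUT-OFF profile meets identically; hence for cut-off profiles (O3′) at EVERY pair `(𝕋, Λ₁)` ⟺ «`slotT_1(s′) ≡ 0` OR
old side `=` new side a.e. on the (3.2)-SMALL fields of the support» (§3; ⇐ by C §2 + the cut-off), and the first 𝐓-law `TLaw₁₃CoPH θ p 0` demands at every such pair exactly that,
with its own terms (§3).  With print's (3.2) characteristic function of `V_1` as the profile the hypotheses `hcut` are discharged (§4).  What such a `θ` owes the first 𝐓-law on the whole
Ω-top family is therefore the first-step identities on the small fields — [III] Thm 1 ∕ §3 proper, DISPLAYED as one side of an `↔`, never claimed.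

WHAT THIS FILE PROVES (0 `def`, 0 `sorry`, standard axioms).  §1 (every level `k`) ★ `WtOfRecord₁₃H_ζ_baseCfg_of_newFieldShape_at` (`ζ_k(Y)(base_{k+1}V′) = g Y V′`) · ★★
`sect2Slot_eq_profile_mul_of_Omega_univ_of_newFieldShape` (new side `= g ∅ V′ · I_k(s′)(V′)`) · `sect2Slot_apply_eq_zero_of_Omega_univ_of_profile_eq_zero` (`= 0` wherever `g ∅ V′ = 0`).  §2 (first
step) ★★★ `omegaTop_O3_profile_test_of_newFieldShape` ((O3′) ⇒ `slotT ≡ 0 ∨` a.e. on the rough support `g ∅ V′ · I_0(s′)(V′) = 0`).  §3 ★★★★ `omegaTop_O3_iff_small_of_cutoff` ((O3′) at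
`(𝕋, Λ₁)` ⟺ `slotT ≡ 0 ∨` old `=` new a.e. on the SMALL fields of the support) · ★★★★ `omegaTop_S_iff_small_of_cutoff` (post-𝐑 edition, [IV] (0.3)) · ★★★★★ `tLaw₁₃CoPH_zero_omegaTop_small_identity_of_cutoff` (`TLaw₁₃CoPH θ p 0` ⇒ that, at every pair
`(𝕋, Λ₁)`, with the law's own terms).  §4 ★★★★★ `omegaTop_O3_iff_small_of_indicatorShape` (§3 with print's (3.2) indicator of `V_1` as the profile, `hcut` discharged).  §5 ★★ `not_oneScale_of_indicator_of_lt_dist1` · ★★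
`not_oneScale_of_indicator_su2` (the rough witness of the companion's `not_oneScale_of_indicator` DISCHARGED: every `N` from one group element beyond the threshold, `SU(2)` under
the guards alone — the parameters of the door are OUTSIDE the degeneracy class of A ∕ C under A §3's own guards).

HONEST FRAMING.  A READING on the tree's own rows and objects (count-neutral, LOCATED): nothing of Bałaban asserted or refuted — print's `ζ(Ω^c_{k+1})` is a specific resummation (p.267) of
which `g` is only the SHAPE; the first-step identities on the small fields are DISPLAYED, never claimed; no positivity ∕ integrability of 11a's fluctuation integral is claimed; K1⁹'s `∃θ`
NOT advanced and NOT refuted; no `Stage13HParams` of record constructed or modified; N11 NOT discharged; K1⁹ NOT closed; no registered stub touched; counts unmoved (typed 28∕28 · discharged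
8∕27).  One finite four-torus programme at fixed `ε = L^{−K}`; NOT ℝ⁴, NOT OS, NOT a mass gap, NOT Clay.  No `sorry`, `axiom`, `def`, `instance`, `notation`.  Sources (SHAPE only): [III] Thm 1
p.262, (2.18) p.257, (2.21)–(2.23) p.258, p.267, (3.1)–(3.5) pp.264–265, (3.16) p.268, (3.20)–(3.21) p.269, (3.23)–(3.25) p.270; [B7] Prop. 2 (53) p.26; [I] Thm 1 p.259.
-/

noncomputable section

open MeasureTheory
open scoped BigOperators Matrix.Norms.L2Operator

namespace Summit.QuantumFields.YangMills.Theorems.BalabanUVNodesN11OmegaTopAtNewFieldShape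

open Literature.MathematicalPhysics.QuantumFieldTheory.Balaban1983to89 T4Continuum Node00 Node00.Tk B14.Eq218Concrete B14.Sect3Decomp
open Literature.MathematicalPhysics.QuantumFieldTheory.Balaban1983to89.ExpMeanLog (deltaSU)
open B14.Eq213MaximalDomains (side)
open BalabanUVNodesN11OmegaTopTStep (sect2Slot_eq_of_Omega_univ)
open BalabanUVNodesN11OmegaTopLocalResidual (slotsT_one_ae_zero_on_rough_of_Omega_univ slots_one_ae_zero_on_rough_of_Omega_univ)
open BalabanUVNodesN11TopPairLocalResidual (WtOfRecord₁₃H_ζ_eq_ζ0)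
open BalabanUVNodesN11AllLargeFieldLabel (sideD_pos sideχ_pos)
open BalabanUVNodesN11TopPairRoughSet (not_plaqSmall_of_cubeRough exists_cubeRoughStrict_of_lt_dist1)
open BalabanUVNodesN11TopPairRoughWitness (nonempty_Iχ)
open BalabanUVNodesN11TopPairAtNewFieldShape (smallFieldIndicator_cut not_oneScale_of_indicator)
open Summit.QuantumFields.YangMills.BalabanUVNodes.N07Thm1ScaledInterfaceInstance (su2_dist1_surj)

variable {F : T4Family} {N : ℕ} [NeZero N]

/-! ## §1. Every level: the new side of an Ω-top child is the PROFILE AT `V′` times 11a's fluctuation integral -/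

section NewSide

variable (θ : Stage13HParams F N) (p : B12.RunParams)

/-- ★ **`ζ_k(Y)(base_{k+1}V′) = g Y V′` AT EVERY `θ` WHOSE GENERATION-`k` FACTOR HAS THE NEW-FIELD SHAPE** (every level; the level-`k+1` component of `base_{k+1}(V′)` IS `V′`): the value
DEPENDS on `V′` — contrast `…N11TopPairLocalResidual.WtOfRecord₁₃H_ζ_baseCfg_eq_of_localLaws` (constant in `V′` under the one-scale law). [cite: Balaban1988Convergent, (2.18) p.257, (3.2) p.265, p.267] -/
theorem WtOfRecord₁₃H_ζ_baseCfg_of_newFieldShape_at {n k : ℕ} (s : SeqOfRecord F θ.ν θ.τ9.M (gOfRecord₁₃ F N θ.toStage13Params p) p.K n)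
    {g : Set (Site (F.P p.K) 0) → GaugeField (F.P p.K) (k + 1) (SU N) → ℝ} (hζ : ∀ Y ω, (θ.Zh p n s.Ω s.Λ).ζ0 k Y ω = g Y (ω (k + 1)).1)
    (Y : Set (Site (F.P p.K) 0)) (V' : GaugeField (F.P p.K) (k + 1) (SU N)) :
    (WtOfRecord₁₃H F N θ p s).ζ k Y (baseCfg (V := FluctV N) (k + 1) V') = g Y V' := by
  rw [WtOfRecord₁₃H_ζ_eq_ζ0, hζ]
  exact congrArg (g Y) (funext fun b => baseCfg_fst_self (V := FluctV N) (k + 1) V' b)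

/-- ★★ **THE NEW SIDE OF A CHILD WITH `Ω_{k+1}(s′) = 𝕋` AT SUCH A `θ`**: `sect2Slot(W^θ(s′), s′, t, E′, U)(V′) = g ∅ V′ · Σ_Y aOp_k[…](base_{k+1}V′)` — g18 D2's closed form with the
residual factor READ AT `V′` (C §1 had the `V′`-independent `c_k(s′) = ζ_k(∅)(base_{k+1} 1)` in front). [cite: Balaban1988Convergent, (2.18) p.257, (2.21)–(2.23) p.258, p.267, (3.2) p.265, (3.23)–(3.25) p.270] -/
theorem sect2Slot_eq_profile_mul_of_Omega_univ_of_newFieldShape {𝔸 : Type*} [NormedRing 𝔸] [NormedAlgebra ℂ 𝔸] [CompleteSpace 𝔸] {k : ℕ}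
    (s' : SeqOfRecord F θ.ν θ.τ9.M (gOfRecord₁₃ F N θ.toStage13Params p) p.K (k + 1))
    {g : Set (Site (F.P p.K) 0) → GaugeField (F.P p.K) (k + 1) (SU N) → ℝ} (hζ : ∀ Y ω, (θ.Zh p (k + 1) s'.Ω s'.Λ).ζ0 k Y ω = g Y (ω (k + 1)).1) (hΩ : s'.Ω (k + 1) = Set.univ)
    (Sg : Sect2.Setting 𝔸 (SU N)) (Rz : Sect2.Residual (F.P p.K) 𝔸) (t : Sect2.TermValues (F.P p.K) 𝔸 (FluctV N) θ.τ9.M) (E' : ℝ) (U : BgMap F N p.K)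
    (V' : GaugeField (F.P p.K) (k + 1) (SU N)) {hdec : DecidableEq (PBond (F.P p.K) k)} :
    sect2Slot F N (FluctV N) p.K Sg Rz (WtOfRecord₁₃H F N θ p s') s' t E' U V' =
      g ∅ V' *
        ∑ Y ∈ (Set.toFinite {Y : Set (Site (F.P p.K) 0) | Y ∈ SClassOfRecord F θ.ν (gOfRecord₁₃ F N θ.toStage13Params p) p.K (k + 1) ∧ Y ⊆ s'.Ω (k + 1) ∩ (s'.Λ (k + 1))ᶜ}).toFinset,
          aOp k (genDataOfRecord F N (FluctV N) θ.ν θ.τ9.M (gOfRecord₁₃ F N θ.toStage13Params p) p.K (WtOfRecord₁₃H F N θ p s') s' (Function.update (fun _ => ∅) (k + 1) Y) k).sA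
            (genDataOfRecord F N (FluctV N) θ.ν θ.τ9.M (gOfRecord₁₃ F N θ.toStage13Params p) p.K (WtOfRecord₁₃H F N θ p s') s' (Function.update (fun _ => ∅) (k + 1) Y) k).w
            (fun ω => (∏ j ∈ Finset.range k, (WtOfRecord₁₃H F N θ p s').ζ j ∅ ω * (WtOfRecord₁₃H F N θ p s').w j Set.univ ∅ ∅ ω) *
              sect2Operand F N (FluctV N) p.K Sg Rz s' t E' U (Function.update (fun _ => ∅) (k + 1) Y, fun j => (ω j).2) (fun j => (ω j).1))
            (baseCfg (k + 1) V') := by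
  rw [sect2Slot_eq_of_Omega_univ F N θ.ν θ.τ9 p (gOfRecord₁₃ F N θ.toStage13Params p) k Sg Rz (WtOfRecord₁₃H F N θ p s') s' hΩ t E' U V' (hdec := hdec),
    Finset.mul_sum]
  refine Finset.sum_congr rfl fun Y _ => ?_
  congr 1
  rw [hΩ, Set.compl_univ]
  exact WtOfRecord₁₃H_ζ_baseCfg_of_newFieldShape_at θ p s' hζ ∅ V'

/-- **… so the new side VANISHES AT EVERY `V′` THE PROFILE CUTS OFF** (`g ∅ V′ = 0`) — pointwise, whatever the term values, constant and background map (C §1: the whole function vanished iff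
the constant did). [cite: Balaban1988Convergent, (2.18) p.257, (3.2) p.265, (3.25) p.270 (bookkeeping)] -/
theorem sect2Slot_apply_eq_zero_of_Omega_univ_of_profile_eq_zero {𝔸 : Type*} [NormedRing 𝔸] [NormedAlgebra ℂ 𝔸] [CompleteSpace 𝔸] {k : ℕ}
    (s' : SeqOfRecord F θ.ν θ.τ9.M (gOfRecord₁₃ F N θ.toStage13Params p) p.K (k + 1))
    {g : Set (Site (F.P p.K) 0) → GaugeField (F.P p.K) (k + 1) (SU N) → ℝ} (hζ : ∀ Y ω, (θ.Zh p (k + 1) s'.Ω s'.Λ).ζ0 k Y ω = g Y (ω (k + 1)).1) (hΩ : s'.Ω (k + 1) = Set.univ)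
    (Sg : Sect2.Setting 𝔸 (SU N)) (Rz : Sect2.Residual (F.P p.K) 𝔸) (t : Sect2.TermValues (F.P p.K) 𝔸 (FluctV N) θ.τ9.M) (E' : ℝ) (U : BgMap F N p.K)
    {V' : GaugeField (F.P p.K) (k + 1) (SU N)} (hV' : g ∅ V' = 0) :
    sect2Slot F N (FluctV N) p.K Sg Rz (WtOfRecord₁₃H F N θ p s') s' t E' U V' = 0 := by
  classical
  rw [sect2Slot_eq_profile_mul_of_Omega_univ_of_newFieldShape θ p s' hζ hΩ Sg Rz t E' U V' (hdec := fun a b => Classical.propDecidable (a = b)), hV', zero_mul]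

end NewSide

/-! ## §2. First step: g19's Ω-top test at the door — a condition on the PROFILE times the fluctuation integral -/

section Test

variable (θ : Stage13HParams F N) (p : B12.RunParams)

/-- ★★★ **THE Ω-TOP TEST AT EVERY `θ` WHOSE GENERATION-0 FACTOR HAS THE NEW-FIELD SHAPE** (first step; `1 ≤ M`, `0 < M₂`, `0 < K`, the `α₀` guards, `ε₁η₁² + 8δ₀ ≤ α₀η₁²`): for a history `s′`
of length `1` with `Ω₁(s′) = 𝕋` (any `Λ₁`) and any first-step terms `(u₁, e₁)`, (O3′) at `s′` implies `slotT_1(s′) ≡ 0` OR, for a.e. `V′` with `χ₁(s′)V′ ≠ 0` and `¬PlaqSmall(2α₀(Lη₁)²) V′`,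
`g ∅ V′ · I_0(s′)(V′) = 0` — C §3 had «`c_0(s′) = 0 ∨ I_0(s′)(V′) = 0` a.e. there» with a `V′`-independent constant. [cite: Balaban1988Convergent, Thm 1 p.262, (3.1)–(3.5) pp.264–265, (3.23)–(3.25) p.270, p.267; Balaban1985Averaging, Prop. 2 (53) p.26] -/
theorem omegaTop_O3_profile_test_of_newFieldShape (hM : 1 ≤ θ.τ9.M) (hM₂ : 0 < θ.ν.M₂) (hK : 0 < p.K) {α₀ : ℝ} (hα : 0 < α₀)
    (hα3 : (143 * (((((F.P p.K).d + 4 : ℕ) : ℝ)) ^ 2 / 4) ^ 2) * α₀ ≤ 1 / 3)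
    (hα2 : 2 * α₀ ≤ 2 * deltaSU (Fin N) / ((((F.P p.K).d + 4) * (F.P p.K).L : ℕ) : ℝ) ^ 2)
    (hαε : epsOfRecord θ.ν (gOfRecord₁₃ F N θ.toStage13Params p) 1 * (F.P p.K).eta 1 ^ 2 + 4 * (2 * deltaOfRecord θ.ν (gOfRecord₁₃ F N θ.toStage13Params p) 0 θ.A₁) ≤
      α₀ * (F.P p.K).eta 1 ^ 2)
    (s' : SeqOfRecord F θ.ν θ.τ9.M (gOfRecord₁₃ F N θ.toStage13Params p) p.K 1)
    {g : Set (Site (F.P p.K) 0) → GaugeField (F.P p.K) 1 (SU N) → ℝ} (hζ : ∀ Y ω, (θ.Zh p 1 s'.Ω s'.Λ).ζ0 0 Y ω = g Y (ω 1).1) (hΩ : s'.Ω 1 = Set.univ)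
    (u₁ : Sect2.TermValues (F.P p.K) (MatA N) (FluctV N) θ.τ9.M) (e₁ : ℝ) {hdec : DecidableEq (PBond (F.P p.K) 0)}
    (hO3 : slotsTOfRecord F N θ.ν θ.τ9 (EOfRecord₁₃ F N θ.toStage13Params) (wOfRecord₉ F N θ.toStage9Params) θ.ppSel p (gOfRecord₁₃ F N θ.toStage13Params p) 1 s' = 0 ∨
      ∀ᵐ V' ∂fieldMeasure (F.P p.K) 1 (SU N),
        chiSeqOfRecord F N θ.ν θ.τ9.M (gOfRecord₁₃ F N θ.toStage13Params p) p.K 1 s' V' ≠ 0 →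
          slotsTOfRecord F N θ.ν θ.τ9 (EOfRecord₁₃ F N θ.toStage13Params) (wOfRecord₉ F N θ.toStage9Params) θ.ppSel p (gOfRecord₁₃ F N θ.toStage13Params p) 1 s' V' =
            sect2Slot F N (FluctV N) p.K (settingOfRecord₁₃ F N θ.toStage13Params p) (θ.rzAt p s') (WtOfRecord₁₃H F N θ p s') s' u₁ e₁
              (UbgOfRecord₁₃CoP F N θ.toStage13Params p 1 s') V') :
    slotsTOfRecord F N θ.ν θ.τ9 (EOfRecord₁₃ F N θ.toStage13Params) (wOfRecord₉ F N θ.toStage9Params) θ.ppSel p (gOfRecord₁₃ F N θ.toStage13Params p) 1 s' = 0 ∨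
      ∀ᵐ V' ∂fieldMeasure (F.P p.K) 1 (SU N),
        chiSeqOfRecord F N θ.ν θ.τ9.M (gOfRecord₁₃ F N θ.toStage13Params p) p.K 1 s' V' ≠ 0 →
          ¬ PlaqSmall (2 * α₀ * (((F.P p.K).L : ℝ) ^ 1 * (F.P p.K).eta 1) ^ 2) V' →
            g ∅ V' *
              (∑ Y ∈ (Set.toFinite {Y : Set (Site (F.P p.K) 0) | Y ∈ SClassOfRecord F θ.ν (gOfRecord₁₃ F N θ.toStage13Params p) p.K 1 ∧ Y ⊆ s'.Ω 1 ∩ (s'.Λ 1)ᶜ}).toFinset,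
                aOp 0 (genDataOfRecord F N (FluctV N) θ.ν θ.τ9.M (gOfRecord₁₃ F N θ.toStage13Params p) p.K (WtOfRecord₁₃H F N θ p s') s' (Function.update (fun _ => ∅) 1 Y) 0).sA
                  (genDataOfRecord F N (FluctV N) θ.ν θ.τ9.M (gOfRecord₁₃ F N θ.toStage13Params p) p.K (WtOfRecord₁₃H F N θ p s') s' (Function.update (fun _ => ∅) 1 Y) 0).w
                  (fun ω => (∏ j ∈ Finset.range 0, (WtOfRecord₁₃H F N θ p s').ζ j ∅ ω * (WtOfRecord₁₃H F N θ p s').w j Set.univ ∅ ∅ ω) *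
                    sect2Operand F N (FluctV N) p.K (settingOfRecord₁₃ F N θ.toStage13Params p) (θ.rzAt p s') s' u₁ e₁ (UbgOfRecord₁₃CoP F N θ.toStage13Params p 1 s')
                      (Function.update (fun _ => ∅) 1 Y, fun j => (ω j).2) (fun j => (ω j).1))
                  (baseCfg 1 V')) = 0 := by
  rcases hO3 with h0 | hid
  · exact Or.inl h0
  · refine Or.inr ?_
    have hz := slotsT_one_ae_zero_on_rough_of_Omega_univ θ.ν θ.τ9 (EOfRecord₁₃ F N θ.toStage13Params) θ.A₁ θ.ζ θ.ppSel p (gOfRecord₁₃ F N θ.toStage13Params p) hK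
      (sideD_pos θ.ν hM p _ 0) (sideχ_pos hM₂ p _ 0) hα hα3 hα2 hαε s' hΩ
    filter_upwards [hid, hz] with V' hV' hzV' hχ hrough
    have h1 := hV' hχ
    rw [hzV' hrough, sect2Slot_eq_profile_mul_of_Omega_univ_of_newFieldShape θ p s' hζ hΩ _ _ u₁ e₁ _ V' (hdec := hdec)] at h1
    exact h1.symm

end Test

/-! ## §3. First step, cut-off profiles: the (O3′) clause of EVERY pair `(𝕋, Λ₁)` IS its restriction to the (3.2)-small coarse fields -/

section Door

variable (θ : Stage13HParams F N) (p : B12.RunParams)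

/-- ★★★★ **THE (O3′) CLAUSE OF EVERY Ω-TOP PAIR `(𝕋, Λ₁)` REDUCES EXACTLY TO THE SMALL FIELDS** at every `θ` whose generation-0 factor has the new-field shape with a CUT-OFF profile
(`hcut`; first step; `1 ≤ M`, `0 < M₂`, `0 < K`, the `α₀` guards, `ε₁η₁² + 8δ₀ ≤ α₀η₁²`): (O3′) ⟺ `slotT_1(s′) ≡ 0` OR old side `=` new side for a.e. `V′` with `χ₁(s′)V′ ≠ 0` AND
`PlaqSmall(2α₀(Lη₁)²) V′`.  (⇐): on the rough fields both sides vanish a.e. — the old side by C §2 `slotsT_one_ae_zero_on_rough_of_Omega_univ` ([B7] Prop. 2), the new side by §1 and the cut-off.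
[cite: Balaban1988Convergent, Thm 1 p.262, (3.1)–(3.5) pp.264–265, (3.23)–(3.25) p.270, p.267; Balaban1985Averaging, Prop. 2 (53) p.26; Balaban1987RG1, Thm 1 p.259] -/
theorem omegaTop_O3_iff_small_of_cutoff (hM : 1 ≤ θ.τ9.M) (hM₂ : 0 < θ.ν.M₂) (hK : 0 < p.K) {α₀ : ℝ} (hα : 0 < α₀)
    (hα3 : (143 * (((((F.P p.K).d + 4 : ℕ) : ℝ)) ^ 2 / 4) ^ 2) * α₀ ≤ 1 / 3)
    (hα2 : 2 * α₀ ≤ 2 * deltaSU (Fin N) / ((((F.P p.K).d + 4) * (F.P p.K).L : ℕ) : ℝ) ^ 2)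
    (hαε : epsOfRecord θ.ν (gOfRecord₁₃ F N θ.toStage13Params p) 1 * (F.P p.K).eta 1 ^ 2 + 4 * (2 * deltaOfRecord θ.ν (gOfRecord₁₃ F N θ.toStage13Params p) 0 θ.A₁) ≤
      α₀ * (F.P p.K).eta 1 ^ 2)
    (s' : SeqOfRecord F θ.ν θ.τ9.M (gOfRecord₁₃ F N θ.toStage13Params p) p.K 1)
    {g : Set (Site (F.P p.K) 0) → GaugeField (F.P p.K) 1 (SU N) → ℝ} (hζ : ∀ Y ω, (θ.Zh p 1 s'.Ω s'.Λ).ζ0 0 Y ω = g Y (ω 1).1) (hΩ : s'.Ω 1 = Set.univ)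
    (hcut : ∀ V', ¬ PlaqSmall (2 * α₀ * (((F.P p.K).L : ℝ) ^ 1 * (F.P p.K).eta 1) ^ 2) V' → g ∅ V' = 0)
    (u₁ : Sect2.TermValues (F.P p.K) (MatA N) (FluctV N) θ.τ9.M) (e₁ : ℝ) :
    (slotsTOfRecord F N θ.ν θ.τ9 (EOfRecord₁₃ F N θ.toStage13Params) (wOfRecord₉ F N θ.toStage9Params) θ.ppSel p (gOfRecord₁₃ F N θ.toStage13Params p) 1 s' = 0 ∨
      ∀ᵐ V' ∂fieldMeasure (F.P p.K) 1 (SU N),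
        chiSeqOfRecord F N θ.ν θ.τ9.M (gOfRecord₁₃ F N θ.toStage13Params p) p.K 1 s' V' ≠ 0 →
          slotsTOfRecord F N θ.ν θ.τ9 (EOfRecord₁₃ F N θ.toStage13Params) (wOfRecord₉ F N θ.toStage9Params) θ.ppSel p (gOfRecord₁₃ F N θ.toStage13Params p) 1 s' V' =
            sect2Slot F N (FluctV N) p.K (settingOfRecord₁₃ F N θ.toStage13Params p) (θ.rzAt p s') (WtOfRecord₁₃H F N θ p s') s' u₁ e₁
              (UbgOfRecord₁₃CoP F N θ.toStage13Params p 1 s') V') ↔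
    (slotsTOfRecord F N θ.ν θ.τ9 (EOfRecord₁₃ F N θ.toStage13Params) (wOfRecord₉ F N θ.toStage9Params) θ.ppSel p (gOfRecord₁₃ F N θ.toStage13Params p) 1 s' = 0 ∨
      ∀ᵐ V' ∂fieldMeasure (F.P p.K) 1 (SU N),
        chiSeqOfRecord F N θ.ν θ.τ9.M (gOfRecord₁₃ F N θ.toStage13Params p) p.K 1 s' V' ≠ 0 →
          PlaqSmall (2 * α₀ * (((F.P p.K).L : ℝ) ^ 1 * (F.P p.K).eta 1) ^ 2) V' →
            slotsTOfRecord F N θ.ν θ.τ9 (EOfRecord₁₃ F N θ.toStage13Params) (wOfRecord₉ F N θ.toStage9Params) θ.ppSel p (gOfRecord₁₃ F N θ.toStage13Params p) 1 s' V' =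
              sect2Slot F N (FluctV N) p.K (settingOfRecord₁₃ F N θ.toStage13Params p) (θ.rzAt p s') (WtOfRecord₁₃H F N θ p s') s' u₁ e₁
                (UbgOfRecord₁₃CoP F N θ.toStage13Params p 1 s') V') := by
  refine or_congr_right ⟨fun h => ?_, fun h => ?_⟩
  · filter_upwards [h] with V' hV' hχ _
    exact hV' hχ
  · have hz := slotsT_one_ae_zero_on_rough_of_Omega_univ θ.ν θ.τ9 (EOfRecord₁₃ F N θ.toStage13Params) θ.A₁ θ.ζ θ.ppSel p (gOfRecord₁₃ F N θ.toStage13Params p) hK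
      (sideD_pos θ.ν hM p _ 0) (sideχ_pos hM₂ p _ 0) hα hα3 hα2 hαε s' hΩ
    filter_upwards [h, hz] with V' hV' hzV' hχ
    by_cases hs : PlaqSmall (2 * α₀ * (((F.P p.K).L : ℝ) ^ 1 * (F.P p.K).eta 1) ^ 2) V'
    · exact hV' hχ hs
    · rw [hzV' hs, sect2Slot_apply_eq_zero_of_Omega_univ_of_profile_eq_zero θ p s' hζ hΩ _ _ u₁ e₁ _ (hcut V' hs)]

/-- ★★★★ **THE POST-𝐑 EDITION** (the §2-form clause of `ρ₁`'s slot at the child — the currency of K1⁹'s (B) face, [IV] (0.3) pointwise): for a cut-off profile the clause «`slot_1(s′) ≡ 0`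
OR `slot_1(s′) =` new side a.e. on the support» ⟺ its restriction to the (3.2)-SMALL fields of the support; ⇐ by C §2 `slots_one_ae_zero_on_rough_of_Omega_univ` + §1 + the cut-off.
[cite: Balaban1988Convergent, Thm 1 p.262, (2.18) p.257, (3.1)–(3.5) pp.264–265, (3.23)–(3.25) p.270; Balaban1989LargeFieldI, (0.3) p.176; Balaban1985Averaging, Prop. 2 (53) p.26] -/
theorem omegaTop_S_iff_small_of_cutoff (hM : 1 ≤ θ.τ9.M) (hM₂ : 0 < θ.ν.M₂) (hK : 0 < p.K) {α₀ : ℝ} (hα : 0 < α₀)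
    (hα3 : (143 * (((((F.P p.K).d + 4 : ℕ) : ℝ)) ^ 2 / 4) ^ 2) * α₀ ≤ 1 / 3)
    (hα2 : 2 * α₀ ≤ 2 * deltaSU (Fin N) / ((((F.P p.K).d + 4) * (F.P p.K).L : ℕ) : ℝ) ^ 2)
    (hαε : epsOfRecord θ.ν (gOfRecord₁₃ F N θ.toStage13Params p) 1 * (F.P p.K).eta 1 ^ 2 + 4 * (2 * deltaOfRecord θ.ν (gOfRecord₁₃ F N θ.toStage13Params p) 0 θ.A₁) ≤
      α₀ * (F.P p.K).eta 1 ^ 2)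
    (s' : SeqOfRecord F θ.ν θ.τ9.M (gOfRecord₁₃ F N θ.toStage13Params p) p.K 1)
    {g : Set (Site (F.P p.K) 0) → GaugeField (F.P p.K) 1 (SU N) → ℝ} (hζ : ∀ Y ω, (θ.Zh p 1 s'.Ω s'.Λ).ζ0 0 Y ω = g Y (ω 1).1) (hΩ : s'.Ω 1 = Set.univ)
    (hcut : ∀ V', ¬ PlaqSmall (2 * α₀ * (((F.P p.K).L : ℝ) ^ 1 * (F.P p.K).eta 1) ^ 2) V' → g ∅ V' = 0)
    (u₁ : Sect2.TermValues (F.P p.K) (MatA N) (FluctV N) θ.τ9.M) (e₁ : ℝ) :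
    (slotsOfRecord F N θ.ν θ.τ9 (EOfRecord₁₃ F N θ.toStage13Params) (wOfRecord₉ F N θ.toStage9Params) θ.ppSel p (gOfRecord₁₃ F N θ.toStage13Params p) 1 s' = 0 ∨
      ∀ᵐ V' ∂fieldMeasure (F.P p.K) 1 (SU N),
        chiSeqOfRecord F N θ.ν θ.τ9.M (gOfRecord₁₃ F N θ.toStage13Params p) p.K 1 s' V' ≠ 0 →
          slotsOfRecord F N θ.ν θ.τ9 (EOfRecord₁₃ F N θ.toStage13Params) (wOfRecord₉ F N θ.toStage9Params) θ.ppSel p (gOfRecord₁₃ F N θ.toStage13Params p) 1 s' V' =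
            sect2Slot F N (FluctV N) p.K (settingOfRecord₁₃ F N θ.toStage13Params p) (θ.rzAt p s') (WtOfRecord₁₃H F N θ p s') s' u₁ e₁
              (UbgOfRecord₁₃CoP F N θ.toStage13Params p 1 s') V') ↔
    (slotsOfRecord F N θ.ν θ.τ9 (EOfRecord₁₃ F N θ.toStage13Params) (wOfRecord₉ F N θ.toStage9Params) θ.ppSel p (gOfRecord₁₃ F N θ.toStage13Params p) 1 s' = 0 ∨
      ∀ᵐ V' ∂fieldMeasure (F.P p.K) 1 (SU N),
        chiSeqOfRecord F N θ.ν θ.τ9.M (gOfRecord₁₃ F N θ.toStage13Params p) p.K 1 s' V' ≠ 0 →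
          PlaqSmall (2 * α₀ * (((F.P p.K).L : ℝ) ^ 1 * (F.P p.K).eta 1) ^ 2) V' →
            slotsOfRecord F N θ.ν θ.τ9 (EOfRecord₁₃ F N θ.toStage13Params) (wOfRecord₉ F N θ.toStage9Params) θ.ppSel p (gOfRecord₁₃ F N θ.toStage13Params p) 1 s' V' =
              sect2Slot F N (FluctV N) p.K (settingOfRecord₁₃ F N θ.toStage13Params p) (θ.rzAt p s') (WtOfRecord₁₃H F N θ p s') s' u₁ e₁
                (UbgOfRecord₁₃CoP F N θ.toStage13Params p 1 s') V') := by
  refine or_congr_right ⟨fun h => ?_, fun h => ?_⟩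
  · filter_upwards [h] with V' hV' hχ _
    exact hV' hχ
  · have hz := slots_one_ae_zero_on_rough_of_Omega_univ θ.ν θ.τ9 (EOfRecord₁₃ F N θ.toStage13Params) θ.A₁ θ.ζ θ.ppSel p (gOfRecord₁₃ F N θ.toStage13Params p) hK
      (sideD_pos θ.ν hM p _ 0) (sideχ_pos hM₂ p _ 0) hα hα3 hα2 hαε s' hΩ
    filter_upwards [h, hz] with V' hV' hzV' hχ
    by_cases hs : PlaqSmall (2 * α₀ * (((F.P p.K).L : ℝ) ^ 1 * (F.P p.K).eta 1) ^ 2) V'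
    · exact hV' hχ hs
    · rw [hzV' hs, sect2Slot_apply_eq_zero_of_Omega_univ_of_profile_eq_zero θ p s' hζ hΩ _ _ u₁ e₁ _ (hcut V' hs)]


/-- ★★★★★ **`TLaw₁₃CoPH θ p 0` AT SUCH A PARAMETER DEMANDS, AT EVERY Ω-TOP PAIR `(𝕋, Λ₁)`, EXACTLY THE SMALL-FIELD IDENTITY** — served by the law's own witness terms `(t s′, E s′)`; cut-off
profile; same guards.  Contrast C §4 (`tLaw₁₃CoPH_zero_omegaTop_trichotomy` under `hzh`: 𝐓-slot `≡ 0` ∨ `c_0(s′) = 0` ∨ the fluctuation integral vanishes a.e. on the rough support).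
[cite: Balaban1988Convergent, Thm 1 p.262, remark p.262, Def. p.279, (3.1)–(3.5) pp.264–265, (3.23)–(3.25) p.270, p.267; Balaban1985Averaging, Prop. 2 (53) p.26; Balaban1987RG1, Thm 1 p.259] -/
theorem tLaw₁₃CoPH_zero_omegaTop_small_identity_of_cutoff (hM : 1 ≤ θ.τ9.M) (hM₂ : 0 < θ.ν.M₂) (hK : 0 < p.K) {α₀ : ℝ} (hα : 0 < α₀)
    (hα3 : (143 * (((((F.P p.K).d + 4 : ℕ) : ℝ)) ^ 2 / 4) ^ 2) * α₀ ≤ 1 / 3)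
    (hα2 : 2 * α₀ ≤ 2 * deltaSU (Fin N) / ((((F.P p.K).d + 4) * (F.P p.K).L : ℕ) : ℝ) ^ 2)
    (hαε : epsOfRecord θ.ν (gOfRecord₁₃ F N θ.toStage13Params p) 1 * (F.P p.K).eta 1 ^ 2 + 4 * (2 * deltaOfRecord θ.ν (gOfRecord₁₃ F N θ.toStage13Params p) 0 θ.A₁) ≤
      α₀ * (F.P p.K).eta 1 ^ 2)
    (hT : TLaw₁₃CoPH F N θ p 0)
    (s' : SeqOfRecord F θ.ν θ.τ9.M (gOfRecord₁₃ F N θ.toStage13Params p) p.K 1)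
    {g : Set (Site (F.P p.K) 0) → GaugeField (F.P p.K) 1 (SU N) → ℝ} (hζ : ∀ Y ω, (θ.Zh p 1 s'.Ω s'.Λ).ζ0 0 Y ω = g Y (ω 1).1) (hΩ : s'.Ω 1 = Set.univ)
    (hcut : ∀ V', ¬ PlaqSmall (2 * α₀ * (((F.P p.K).L : ℝ) ^ 1 * (F.P p.K).eta 1) ^ 2) V' → g ∅ V' = 0) :
    ∃ (u₁ : Sect2.TermValues (F.P p.K) (MatA N) (FluctV N) θ.τ9.M) (e₁ : ℝ),
      slotsTOfRecord F N θ.ν θ.τ9 (EOfRecord₁₃ F N θ.toStage13Params) (wOfRecord₉ F N θ.toStage9Params) θ.ppSel p (gOfRecord₁₃ F N θ.toStage13Params p) 1 s' = 0 ∨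
        ∀ᵐ V' ∂fieldMeasure (F.P p.K) 1 (SU N),
          chiSeqOfRecord F N θ.ν θ.τ9.M (gOfRecord₁₃ F N θ.toStage13Params p) p.K 1 s' V' ≠ 0 →
            PlaqSmall (2 * α₀ * (((F.P p.K).L : ℝ) ^ 1 * (F.P p.K).eta 1) ^ 2) V' →
              slotsTOfRecord F N θ.ν θ.τ9 (EOfRecord₁₃ F N θ.toStage13Params) (wOfRecord₉ F N θ.toStage9Params) θ.ppSel p (gOfRecord₁₃ F N θ.toStage13Params p) 1 s' V' =
                sect2Slot F N (FluctV N) p.K (settingOfRecord₁₃ F N θ.toStage13Params p) (θ.rzAt p s') (WtOfRecord₁₃H F N θ p s') s' u₁ e₁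
                  (UbgOfRecord₁₃CoP F N θ.toStage13Params p 1 s') V' := by
  obtain ⟨t, Ek, -, hall⟩ := (tLaw₁₃CoPH_iff F N θ p 0).1 hT
  exact ⟨t s', Ek s', (omegaTop_O3_iff_small_of_cutoff θ p hM hM₂ hK hα hα3 hα2 hαε s' hζ hΩ hcut (t s') (Ek s')).1 (hall s').2⟩

end Door

/-! ## §4. Print's (3.2) characteristic function of `V_1` AS the profile: `hcut` discharged -/

section Indicator

variable (θ : Stage13HParams F N) (p : B12.RunParams)

/-- ★★★★★ **EVERY Ω-TOP PAIR AT A PARAMETER WHOSE STEP-1 RESIDUAL FACTOR IS THE (3.2) CHARACTERISTIC FUNCTION OF THE NEW FIELD** (`g Y V′ = 𝟙{PlaqSmall(2α₀(Lη₁)²) V′}`; first step; same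
guards): (O3′) at `(𝕋, Λ₁)` ⟺ `slotT_1(s′) ≡ 0` OR old side `=` new side a.e. on the SMALL fields of the support — §3 with `hcut` DISCHARGED (`…TopPairAtNewFieldShape.smallFieldIndicator_cut`).
[cite: Balaban1988Convergent, Thm 1 p.262, (3.1)–(3.5) pp.264–265, (3.23)–(3.25) p.270, p.267; Balaban1985Averaging, Prop. 2 (53) p.26; Balaban1987RG1, Thm 1 p.259] -/
theorem omegaTop_O3_iff_small_of_indicatorShape (hM : 1 ≤ θ.τ9.M) (hM₂ : 0 < θ.ν.M₂) (hK : 0 < p.K) {α₀ : ℝ} (hα : 0 < α₀)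
    (hα3 : (143 * (((((F.P p.K).d + 4 : ℕ) : ℝ)) ^ 2 / 4) ^ 2) * α₀ ≤ 1 / 3)
    (hα2 : 2 * α₀ ≤ 2 * deltaSU (Fin N) / ((((F.P p.K).d + 4) * (F.P p.K).L : ℕ) : ℝ) ^ 2)
    (hαε : epsOfRecord θ.ν (gOfRecord₁₃ F N θ.toStage13Params p) 1 * (F.P p.K).eta 1 ^ 2 + 4 * (2 * deltaOfRecord θ.ν (gOfRecord₁₃ F N θ.toStage13Params p) 0 θ.A₁) ≤
      α₀ * (F.P p.K).eta 1 ^ 2)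
    (s' : SeqOfRecord F θ.ν θ.τ9.M (gOfRecord₁₃ F N θ.toStage13Params p) p.K 1)
    (hζ : ∀ Y ω, (θ.Zh p 1 s'.Ω s'.Λ).ζ0 0 Y ω =
      Set.indicator {W : GaugeField (F.P p.K) 1 (SU N) | PlaqSmall (2 * α₀ * (((F.P p.K).L : ℝ) ^ 1 * (F.P p.K).eta 1) ^ 2) W} 1 (ω 1).1)
    (hΩ : s'.Ω 1 = Set.univ) (u₁ : Sect2.TermValues (F.P p.K) (MatA N) (FluctV N) θ.τ9.M) (e₁ : ℝ) :
    (slotsTOfRecord F N θ.ν θ.τ9 (EOfRecord₁₃ F N θ.toStage13Params) (wOfRecord₉ F N θ.toStage9Params) θ.ppSel p (gOfRecord₁₃ F N θ.toStage13Params p) 1 s' = 0 ∨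
      ∀ᵐ V' ∂fieldMeasure (F.P p.K) 1 (SU N),
        chiSeqOfRecord F N θ.ν θ.τ9.M (gOfRecord₁₃ F N θ.toStage13Params p) p.K 1 s' V' ≠ 0 →
          slotsTOfRecord F N θ.ν θ.τ9 (EOfRecord₁₃ F N θ.toStage13Params) (wOfRecord₉ F N θ.toStage9Params) θ.ppSel p (gOfRecord₁₃ F N θ.toStage13Params p) 1 s' V' =
            sect2Slot F N (FluctV N) p.K (settingOfRecord₁₃ F N θ.toStage13Params p) (θ.rzAt p s') (WtOfRecord₁₃H F N θ p s') s' u₁ e₁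
              (UbgOfRecord₁₃CoP F N θ.toStage13Params p 1 s') V') ↔
    (slotsTOfRecord F N θ.ν θ.τ9 (EOfRecord₁₃ F N θ.toStage13Params) (wOfRecord₉ F N θ.toStage9Params) θ.ppSel p (gOfRecord₁₃ F N θ.toStage13Params p) 1 s' = 0 ∨
      ∀ᵐ V' ∂fieldMeasure (F.P p.K) 1 (SU N),
        chiSeqOfRecord F N θ.ν θ.τ9.M (gOfRecord₁₃ F N θ.toStage13Params p) p.K 1 s' V' ≠ 0 →
          PlaqSmall (2 * α₀ * (((F.P p.K).L : ℝ) ^ 1 * (F.P p.K).eta 1) ^ 2) V' →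
            slotsTOfRecord F N θ.ν θ.τ9 (EOfRecord₁₃ F N θ.toStage13Params) (wOfRecord₉ F N θ.toStage9Params) θ.ppSel p (gOfRecord₁₃ F N θ.toStage13Params p) 1 s' V' =
              sect2Slot F N (FluctV N) p.K (settingOfRecord₁₃ F N θ.toStage13Params p) (θ.rzAt p s') (WtOfRecord₁₃H F N θ p s') s' u₁ e₁
                (UbgOfRecord₁₃CoP F N θ.toStage13Params p 1 s') V') :=
  omegaTop_O3_iff_small_of_cutoff θ p hM hM₂ hK hα hα3 hα2 hαε s'
    (g := fun _ V => Set.indicator {W : GaugeField (F.P p.K) 1 (SU N) | PlaqSmall (2 * α₀ * (((F.P p.K).L : ℝ) ^ 1 * (F.P p.K).eta 1) ^ 2) W} 1 V)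
    hζ hΩ (fun _ hV' => smallFieldIndicator_cut p hV') u₁ e₁

end Indicator


/-! ## §5. The parameters of the door are OUTSIDE the degeneracy class — the rough witness of `…TopPairAtNewFieldShape.not_oneScale_of_indicator` DISCHARGED (every `N` from one
group element beyond the threshold; `SU(2)` under the guards alone) -/

section Outside

/-- ★★ **EVERY `N`, ONE GROUP ELEMENT BEYOND THE THRESHOLD: with the (3.2) indicator profile the displayed one-scale law `hzh` FAILS** (`1 ≤ M₂`, `2α₀(Lη₁)² ≤ 2εreg < dist1 g₀`): g18's
strictly cube-rough coarse field (`…TopPairRoughSet.exists_cubeRoughStrict_of_lt_dist1`, [I] (0.4)'s continuous averaging) is rough at the threshold (`not_plaqSmall_of_cubeRough`), the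
unit field is small — so A §2–§5 ∕ C §3–§4 (the located degeneracy under `hzh`) do NOT apply to a parameter of this shape, under the same guards as A §3.
[cite: Balaban1988Convergent, (2.18) p.257, (3.2) p.265, p.267, (2.12) p.256; Balaban1987RG1, (0.3)–(0.4) pp.252–253; Balaban1985Averaging, (9) p.18, (10) p.19] -/
theorem not_oneScale_of_indicator_of_lt_dist1 (θ : Stage13HParams F N) (p : B12.RunParams) {n : ℕ}
    (s : SeqOfRecord F θ.ν θ.τ9.M (gOfRecord₁₃ F N θ.toStage13Params p) p.K n) (hM₂ : 1 ≤ θ.ν.M₂) {α₀ : ℝ} (hα : 0 < α₀)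
    (hαr : 2 * α₀ * (((F.P p.K).L : ℝ) ^ 1 * (F.P p.K).eta 1) ^ 2 ≤ 2 * θ.ν.εreg) (g₀ : SU N) (hg₀ : 2 * θ.ν.εreg < dist1 g₀)
    (hζ : ∀ Y ω, (θ.Zh p n s.Ω s.Λ).ζ0 0 Y ω =
      Set.indicator {W : GaugeField (F.P p.K) 1 (SU N) | PlaqSmall (2 * α₀ * (((F.P p.K).L : ℝ) ^ 1 * (F.P p.K).eta 1) ^ 2) W} 1 (ω 1).1) :
    ¬ ∀ Y ω ω', ω 0 = ω' 0 → (θ.Zh p n s.Ω s.Λ).ζ0 0 Y ω = (θ.Zh p n s.Ω s.Λ).ζ0 0 Y ω' := by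
  obtain ⟨c₀⟩ := nonempty_Iχ θ.ν p (gOfRecord₁₃ F N θ.toStage13Params p) (sideχ_pos hM₂ p _ 0)
  obtain ⟨V₀, hV₀⟩ := exists_cubeRoughStrict_of_lt_dist1 θ.ν p (gOfRecord₁₃ F N θ.toStage13Params p) hM₂ g₀ hg₀
  exact not_oneScale_of_indicator θ p s hα hζ V₀
    (not_plaqSmall_of_cubeRough θ.ν p (gOfRecord₁₃ F N θ.toStage13Params p) hαr c₀ V₀ fun c => (hV₀ c).imp fun q h => ⟨h.1, h.2.1, h.2.2.1, h.2.2.2.le⟩)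

/-- ★★ **AT `SU(2)`, GUARDS ONLY**: `SU(2)` has an element at distance `2` from `1` (`su2_dist1_surj`) and [B7] Prop. 2's range `143((d+4)²∕4)²·εreg ≤ 1∕3` forces `2εreg < 2` at `d = 4` —
so with the (3.2) indicator profile `hzh` FAILS at every `θ : Stage13HParams F 2` of this shape (`1 ≤ M₂`, `0 < α₀`, `2α₀(Lη₁)² ≤ 2εreg`): the located degeneracy of A ∕ C is a theorem
about OTHER parameters. [cite: Balaban1988Convergent, (2.18) p.257, (3.2) p.265, p.267; Balaban1985Averaging, Prop. 2 (52)–(54) p.26, (10) p.19; Balaban1987RG1, (0.4) p.253] -/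
theorem not_oneScale_of_indicator_su2 (θ : Stage13HParams F 2) (p : B12.RunParams) {n : ℕ}
    (s : SeqOfRecord F θ.ν θ.τ9.M (gOfRecord₁₃ F 2 θ.toStage13Params p) p.K n) (hM₂ : 1 ≤ θ.ν.M₂) {α₀ : ℝ} (hα : 0 < α₀)
    (hαr : 2 * α₀ * (((F.P p.K).L : ℝ) ^ 1 * (F.P p.K).eta 1) ^ 2 ≤ 2 * θ.ν.εreg)
    (hε3 : (143 * (((((F.P p.K).d + 4 : ℕ) : ℝ)) ^ 2 / 4) ^ 2) * θ.ν.εreg ≤ 1 / 3)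
    (hζ : ∀ Y ω, (θ.Zh p n s.Ω s.Λ).ζ0 0 Y ω =
      Set.indicator {W : GaugeField (F.P p.K) 1 (SU 2) | PlaqSmall (2 * α₀ * (((F.P p.K).L : ℝ) ^ 1 * (F.P p.K).eta 1) ^ 2) W} 1 (ω 1).1) :
    ¬ ∀ Y ω ω', ω 0 = ω' 0 → (θ.Zh p n s.Ω s.Λ).ζ0 0 Y ω = (θ.Zh p n s.Ω s.Λ).ζ0 0 Y ω' := by
  obtain ⟨g₀, hg₀⟩ := su2_dist1_surj 2 zero_le_two le_rfl
  have hd : (F.P p.K).d = 4 := rfl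
  have hεlt : 2 * θ.ν.εreg < dist1 g₀ := by
    rw [hg₀]
    rw [hd] at hε3
    norm_num at hε3
    linarith
  exact not_oneScale_of_indicator_of_lt_dist1 θ p s hM₂ hα hαr g₀ hεlt hζ

end Outside

end Summit.QuantumFields.YangMills.Theorems.BalabanUVNodesN11OmegaTopAtNewFieldShape

end
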